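import Summits.CriticalPhenomena.SAWScalingLimit.Theorems.SAWDefectDecoherenceBoundaryClosureRBoundaryBookkeepingPath
import Summits.CriticalPhenomena.SAWScalingLimit.Theorems.SAWDefectDecoherenceBoundaryClosureRBoundaryBookkeepingContour
import HarnessLib

/-!
# Boundary bookkeeping, V: from reachability in the boundary-site graph to the bound [A]

Route `SAWDefectDecoherence`, crux `BoundaryClosureR` (stmt-CriticalPhenomena-14004), line
`pick-half-plane`, wave 4 (the CONTOUR), serving `stub_halfPlaneInputs` (boundary half, root
frame): the registered sub-goals `stub_halfPlaneInputs_boundaryBookkeepingOfReach` — the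
per-domain bookkeeping [A] in the lead's `∃ K`-form (flat floor WITHOUT PINCH, root on the floor,
normaliser `b` off the floor, potential `H`), for every non-interior lattice site `s` REACHABLE from
the normaliser's site `sb` in the BOUNDARY-SITE GRAPH WITHOUT THE ROOT (lattice sites joined across
the `𝕋`-edges dual to boundary darts `(v ∈ Λ, t ∉ Λ)` other than the root) — and
`stub_halfPlaneInputs_segmentEndTwoSidedOfReach`, the TWO-SIDED bound at the two end sites of the
root's floor.  A shortest chain is duplicate-free; it carries a trail of pairwise distinct boundary
darts; the floor minus the root consists of two dead-end corridors of that graph entered only at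
their far ends, so the chain crosses floor darts only TOWARDS the root (and none at all when it ends
at a floor end); `stub_halfPlaneInputs_boundaryBookkeepingPath` then bounds `Re H(s) − Re H(sb)` by
`K · Σ_{darts off the floor} Z` with `K = ‖((2ζ − 1)/3)/2‖ = 1/(2√3)`.  What remains for [A]: every
non-interior lattice site is so reachable (the boundary of a simply connected, connected hex domain
without floor pinch is one circuit through the root).  The `if` in the sums is elaborated with the
instances `Int.decidableLELE` / `instDecidableNot` / `Sym2`'s decidable equality
(`Mathlib.Data.Int.Range`, imported through the bookkeeping file; no `Classical`).
-/

noncomputable section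

open Literature.Probability.LatticeModels Literature.Probability.RandomPlanarGeometry.SAW
open Literature.Barriers.CriticalPhenomena.HexGreen (nbrs mem_nbrs_iff)

namespace Summit.CriticalPhenomena.SAWScalingLimit.Theorems.PickHalfPlane.BoundaryExactness

variable {Λ : Finset HexVertex}

/-- **The bookkeeping from a reachable site** (core of the reduction): flat floor `k₁ ≤ k ≤ k₂`
of row `m` WITHOUT PINCH, root `floorEdge ka m` on it, `H` a potential; if the start `p₀` is no
floor site `(j, m)`, `k₁ < j ≤ k₂`, and `s` is reachable from `p₀` in the boundary-site graph
WITHOUT THE ROOT (sites joined across the `𝕋`-edges dual to boundary darts other than the root),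
then `Re H(s) − Re H(p₀) ≤ ‖((2ζ − 1)/3)/2‖ · Σ_{darts off the floor} Z`.  A shortest chain is
duplicate-free (`SimpleGraph.Walk.bypass`) and carries a trail of pairwise distinct darts
(`exists_trail`, `sites_eq_of_dart`); the floor minus the root is two dead-end corridors entered
only at their far ends (`floorSite_nbr`), so the chain crosses floor darts only TOWARDS the root
(`no_step_to_door`); conclude by `stub_halfPlaneInputs_boundaryBookkeepingPath`. [folklore] -/
theorem reach_re_le (hΛ : hexDomainSimplyConnected Λ) {m k₁ k₂ ka : ℤ}
    (hF4 : ∀ k : ℤ, k₁ ≤ k → k ≤ k₂ → ((![k, m], 0) : HexVertex) ∈ Λ ∧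
      ((![k, m - 1], 1) : HexVertex) ∉ Λ ∧ (k < k₂ → ((![k, m], 1) : HexVertex) ∈ Λ) ∧
      ((![k, m - 1], 0) : HexVertex) ∉ Λ)
    (hka₁ : k₁ ≤ ka) (hka₂ : ka ≤ k₂) {H : Site 2 → ℂ}
    (hH : IsPotential Λ s((((![ka, m - 1] : Site 2)), (1 : Fin 2)), ((![ka, m] : Site 2), (0 : Fin 2))) H)
    {p₀ s : Site 2} (hp₀ : ∀ j : ℤ, k₁ < j → j ≤ k₂ → p₀ ≠ ![j, m])
    (hreach : Relation.ReflTransGen (fun p q : Site 2 => p ≠ q ∧ ∃ v ∈ Λ, ∃ t : HexVertex, t ∉ Λ ∧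
        hexGraph.Adj v t ∧
        s(t, v) ≠ s((((![ka, m - 1] : Site 2)), (1 : Fin 2)), ((![ka, m] : Site 2), (0 : Fin 2))) ∧
        p ∈ hexFaceVertices v ∧ p ∈ hexFaceVertices t ∧
        q ∈ hexFaceVertices v ∧ q ∈ hexFaceVertices t) p₀ s) :
    (H s).re - (H p₀).re ≤ ‖((2 * triZeta - 1) / 3 : ℂ) / 2‖ * ∑ v ∈ Λ, ∑ t ∈ (nbrs v).filter (· ∉ Λ),
        if (∀ k : ℤ, k₁ ≤ k → k ≤ k₂ →
            s(t, v) ≠ s((((![k, m - 1] : Site 2)), (1 : Fin 2)), ((![k, m] : Site 2), (0 : Fin 2))))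
        then ‖hexParafermionicObservable Λ
          s((((![ka, m - 1] : Site 2)), (1 : Fin 2)), ((![ka, m] : Site 2), (0 : Fin 2)))
            hexCriticalFugacity 0 s(t, v)‖ else 0 := by
  classical
  have hF : ∀ k : ℤ, k₁ ≤ k → k ≤ k₂ → ((![k, m], 0) : HexVertex) ∈ Λ ∧
      ((![k, m - 1], 1) : HexVertex) ∉ Λ ∧ (k < k₂ → ((![k, m], 1) : HexVertex) ∈ Λ) :=
    fun k h1 h2 => ⟨(hF4 k h1 h2).1, (hF4 k h1 h2).2.1, (hF4 k h1 h2).2.2.1⟩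
  -- the two sums and the constant
  set root : Sym2 HexVertex :=
    s((((![ka, m - 1] : Site 2)), (1 : Fin 2)), ((![ka, m] : Site 2), (0 : Fin 2))) with hroot
  set Z : HexVertex → HexVertex → ℝ := fun v t =>
    ‖hexParafermionicObservable Λ root hexCriticalFugacity 0 s(t, v)‖ with hZ
  have hsum_le : (∑ v ∈ Λ, ∑ t ∈ (nbrs v).filter (· ∉ Λ),
      if s(t, v) ≠ root ∧ ∀ k : ℤ, k₁ ≤ k → k ≤ k₂ →
          s(t, v) ≠ s(((![k, m - 1], 1) : HexVertex), ((![k, m], 0) : HexVertex))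
      then Z v t else 0) ≤
      ∑ v ∈ Λ, ∑ t ∈ (nbrs v).filter (· ∉ Λ),
        if ∀ k : ℤ, k₁ ≤ k → k ≤ k₂ →
            s(t, v) ≠ s((((![k, m - 1] : Site 2)), (1 : Fin 2)), ((![k, m] : Site 2), (0 : Fin 2)))
        then Z v t else 0 := by
    refine Finset.sum_le_sum fun v _ => Finset.sum_le_sum fun t _ => ?_
    split_ifs with h1 h2
    · exact le_rfl
    · exact absurd h1.2 h2
    · exact norm_nonneg _
    · exact le_rfl
  have hsum0 : 0 ≤ ∑ v ∈ Λ, ∑ t ∈ (nbrs v).filter (· ∉ Λ),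
      if ∀ k : ℤ, k₁ ≤ k → k ≤ k₂ →
          s(t, v) ≠ s((((![k, m - 1] : Site 2)), (1 : Fin 2)), ((![k, m] : Site 2), (0 : Fin 2)))
      then Z v t else 0 :=
    Finset.sum_nonneg fun v _ => Finset.sum_nonneg fun t _ => ite_nonneg (norm_nonneg _) le_rfl
  have hC : ‖(hexCenter ((![ka, m], 0) : HexVertex) - hexCenter ((![ka, m - 1], 1) : HexVertex)) / 2‖
      = ‖((2 * triZeta - 1) / 3 : ℂ) / 2‖ := by
    rw [show hexCenter ((![ka, m], 0) : HexVertex) - hexCenter ((![ka, m - 1], 1) : HexVertex) =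
      (2 * triZeta - 1) / 3 from hexCenter_upFace_sub_belowFace ka m]
  -- the boundary-site graph without the root
  set R : Site 2 → Site 2 → Prop := fun p q => p ≠ q ∧ ∃ v ∈ Λ, ∃ t : HexVertex, t ∉ Λ ∧
    hexGraph.Adj v t ∧ s(t, v) ≠ root ∧ p ∈ hexFaceVertices v ∧ p ∈ hexFaceVertices t ∧
    q ∈ hexFaceVertices v ∧ q ∈ hexFaceVertices t with hR
  have hRsymm : ∀ p q, R p q → R q p := by
    rintro p q ⟨hne, v, hv, t, ht, hvt, hr, hpv, hpt, hqv, hqt⟩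
    exact ⟨hne.symm, v, hv, t, ht, hvt, hr, hqv, hqt, hpv, hpt⟩
  let G' : SimpleGraph (Site 2) := SimpleGraph.fromRel R
  have toReach : ∀ {a b : Site 2}, Relation.ReflTransGen R a b → G'.Reachable a b := by
    intro a b h
    induction h with
    | refl => exact ⟨SimpleGraph.Walk.nil⟩
    | tail _ h ih =>
      exact ih.elim fun W => ⟨W.concat ((SimpleGraph.fromRel_adj R _ _).2 ⟨h.1, Or.inl h⟩)⟩
  -- the trivial case
  by_cases hs : s = p₀
  · subst hs
    rw [sub_self]
    exact mul_nonneg (norm_nonneg _) hsum0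
  -- a duplicate-free chain from `p₀` to `s`
  obtain ⟨W⟩ := toReach hreach
  set L : List (Site 2) := W.bypass.support with hLdef
  have hLnd : L.Nodup := W.bypass_isPath.support_nodup
  have hLch : L.IsChain R :=
    W.bypass.isChain_adj_support.imp fun a b hab =>
      ((SimpleGraph.fromRel_adj R a b).1 hab).2.elim id (hRsymm b a)
  have hL : L = p₀ :: L.tail := (W.bypass.cons_tail_support).symm
  have hLlast : L.getLast (W.bypass.support_ne_nil) = s := W.bypass.getLast_support
  -- the trail along the chain
  set P : Site 2 × Site 2 → HexVertex × HexVertex → Prop := fun pq d =>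
    d.1 ∈ Λ ∧ d.2 ∉ Λ ∧ hexGraph.Adj d.1 d.2 ∧ pq.1 ≠ pq.2 ∧
    pq.1 ∈ hexFaceVertices d.1 ∧ pq.1 ∈ hexFaceVertices d.2 ∧
    pq.2 ∈ hexFaceVertices d.1 ∧ pq.2 ∈ hexFaceVertices d.2 ∧ s(d.2, d.1) ≠ root with hP
  have hchP : (p₀ :: L.tail).IsChain (fun a b => ∃ d, P (a, b) d) := by
    rw [← hL]
    refine hLch.imp fun a b hab => ?_
    obtain ⟨hne, v, hv, t, ht, hvt, hr, hav, hat, hbv, hbt⟩ := hab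
    exact ⟨(v, t), hv, ht, hvt, hne, hav, hat, hbv, hbt, hr⟩
  obtain ⟨T, hTch, hTP, hTnil, hTends, hTmap, hTpos⟩ := exists_trail P p₀ L.tail hchP
  have hT : T ≠ [] := by
    intro h0
    have ht0 : L.tail = [] := hTnil.1 h0
    apply hs
    rw [← hLlast]
    have : L = [p₀] := by rw [hL, ht0]
    simp [this]
  -- darts are pairwise distinct
  have hnd : (T.map Prod.snd).Nodup := by
    refine nodup_darts_of_nodup_sites T ?_ fun st hst st' hst' h => ?_
    · rw [hTmap]
      have hnd' : (p₀ :: L.tail).Nodup := by rw [← hL]; exact hLnd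
      exact edges_nodup hnd'
    · obtain ⟨hv, -, hvt, hpq, hpv, hpt, hqv, hqt, -⟩ := hTP st hst
      obtain ⟨-, -, -, hpq', hpv', hpt', hqv', hqt', -⟩ := hTP st' hst'
      rw [← h] at hpv' hpt' hqv' hqt'
      exact sites_eq_of_dart hvt hpv hpt hqv hqt hpq hpv' hpt' hqv' hqt' hpq'
  have hLhead : ∀ h : L ≠ [], L.head h = p₀ := fun _ => W.bypass.head_support
  -- the side condition: floor darts are crossed towards the root
  have hside : ∀ st ∈ T, ∀ k : ℤ, k₁ ≤ k → k ≤ k₂ →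
      s(st.2.2, st.2.1) = s(((![k, m - 1], 1) : HexVertex), ((![k, m], 0) : HexVertex)) →
      (ka < k → st.1.1 = ![k + 1, m] ∧ st.1.2 = ![k, m]) ∧
      (k < ka → st.1.1 = ![k, m] ∧ st.1.2 = ![k + 1, m]) := by
    intro st hst k hk₁ hk₂ hk
    obtain ⟨hv, ht, hvt, hpq, hpv, hpt, hqv, hqt, hr⟩ := hTP st hst
    have hvt' : st.2.2 = (![k, m - 1], 1) ∧ st.2.1 = (![k, m], 0) := by
      rcases Sym2.eq_iff.1 hk with ⟨h1, h2⟩ | ⟨h1, h2⟩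
      · exact ⟨h1, h2⟩
      · exact absurd (h2 ▸ hv) (hF k hk₁ hk₂).2.1
    rw [hvt'.2] at hpv hqv
    rw [hvt'.1] at hpt hqt
    obtain ⟨A, B, hAB⟩ := hTpos st hst
    rw [← hL] at hAB
    have hp' := floorDart_sites hpv hpt
    have hq' := floorDart_sites hqv hqt
    constructor
    · intro hlt
      rcases hp' with hp1 | hp1 <;> rcases hq' with hq1 | hq1
      · exact absurd (hp1.trans hq1.symm) hpq
      · -- eastward east of the root: excluded by the east corridor
        exfalso
        refine no_step_to_door R hRsymm (fun z => ∃ j : ℤ, ka + 1 ≤ j ∧ j ≤ k ∧ z = ![j, m])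
          (![k + 1, m]) ?_ L hLnd hLch (fun h ⟨j, hj1, hj2, hj⟩ => hp₀ j (by omega) (by omega)
            ((hLhead h).symm.trans hj)) A B (![k, m]) ⟨k, by omega, le_rfl, rfl⟩
          (by rw [hAB, hp1, hq1])
        rintro z ⟨j, hj1, hj2, rfl⟩ q ⟨hne, v', hv', t', ht', hvt', hr', hzv, hzt, hqv', hqt'⟩
        rcases floorSite_nbr hF4 (by omega) (by omega) hv' ht' hvt' hr' hzv hzt hqv' hqt' hne.symm
          with ⟨rfl, hj⟩ | ⟨rfl, hj⟩
        · by_cases hjk : j + 1 ≤ k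
          · exact Or.inl ⟨j + 1, by omega, hjk, rfl⟩
          · exact Or.inr (by rw [show j = k by omega])
        · exact Or.inl ⟨j - 1, by omega, by omega, rfl⟩
      · exact ⟨hp1, hq1⟩
      · exact absurd (hp1.trans hq1.symm) hpq
    · intro hgt
      rcases hp' with hp1 | hp1 <;> rcases hq' with hq1 | hq1
      · exact absurd (hp1.trans hq1.symm) hpq
      · exact ⟨hp1, hq1⟩
      · -- westward west of the root: excluded by the west corridor
        exfalso
        refine no_step_to_door R hRsymm (fun z => ∃ j : ℤ, k + 1 ≤ j ∧ j ≤ ka ∧ z = ![j, m])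
          (![k, m]) ?_ L hLnd hLch (fun h ⟨j, hj1, hj2, hj⟩ => hp₀ j (by omega) (by omega)
            ((hLhead h).symm.trans hj)) A B (![k + 1, m]) ⟨k + 1, le_rfl, by omega, rfl⟩
          (by rw [hAB, hp1, hq1])
        rintro z ⟨j, hj1, hj2, rfl⟩ q ⟨hne, v', hv', t', ht', hvt', hr', hzv, hzt, hqv', hqt'⟩
        rcases floorSite_nbr hF4 (by omega) (by omega) hv' ht' hvt' hr' hzv hzt hqv' hqt' hne.symm
          with ⟨rfl, hj⟩ | ⟨rfl, hj⟩
        · exact Or.inl ⟨j + 1, by omega, by omega, rfl⟩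
        · by_cases hjk : k + 1 ≤ j - 1
          · exact Or.inl ⟨j - 1, hjk, by omega, rfl⟩
          · exact Or.inr (by rw [show j - 1 = k by omega])
      · exact absurd (hp1.trans hq1.symm) hpq
  -- the bookkeeping along the trail
  have key := stub_halfPlaneInputs_boundaryBookkeepingPath Λ hΛ m k₁ k₂ ka hF hka₁ hka₂ H hH T hT
    hTch hnd fun st hst => by
      obtain ⟨hv, ht, hvt, hpq, hpv, hpt, hqv, hqt, -⟩ := hTP st hst
      exact ⟨hv, ht, hvt, hpq, hpv, hpt, hqv, hqt, hside st hst⟩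
  rw [(hTends hT).1, (hTends hT).2, hC] at key
  have hlast : (p₀ :: L.tail).getLast (List.cons_ne_nil _ _) = s := by
    rw [← hLlast]; congr 1; exact hL.symm
  rw [hlast] at key
  exact key.trans (mul_le_mul_of_nonneg_left hsum_le (norm_nonneg _))


/-- The normaliser's site is no floor site `(j, m)`, `k₁ < j ≤ k₂` (the only boundary darts there
are floor darts, and `b` is off the floor). [folklore] -/
theorem normaliserSite_ne_floorSite {m k₁ k₂ : ℤ}
    (hF4 : ∀ k : ℤ, k₁ ≤ k → k ≤ k₂ → ((![k, m], 0) : HexVertex) ∈ Λ ∧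
      ((![k, m - 1], 1) : HexVertex) ∉ Λ ∧ (k < k₂ → ((![k, m], 1) : HexVertex) ∈ Λ) ∧
      ((![k, m - 1], 0) : HexVertex) ∉ Λ)
    {ub wb : HexVertex} (hbadj : hexGraph.Adj ub wb) (hub : ub ∉ Λ) (hwb : wb ∈ Λ)
    (hboff : ∀ k : ℤ, k₁ ≤ k → k ≤ k₂ →
      s(ub, wb) ≠ s((((![k, m - 1] : Site 2)), (1 : Fin 2)), ((![k, m] : Site 2), (0 : Fin 2))))
    {sb : Site 2} (hsbu : sb ∈ hexFaceVertices ub) (hsbw : sb ∈ hexFaceVertices wb) :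
    ∀ j : ℤ, k₁ < j → j ≤ k₂ → sb ≠ ![j, m] := by
  intro j hj₁ hj₂ hsbj
  rw [hsbj] at hsbu hsbw
  rcases floorSite_dart hF4 hj₁ hj₂ hwb hub hbadj.symm hsbw hsbu with ⟨rfl, rfl⟩ | ⟨rfl, rfl⟩
  · exact hboff (j - 1) (by omega) (by omega) rfl
  · exact hboff j (by omega) (by omega) rfl

/-- **Registered sub-goal `stub_halfPlaneInputs_boundaryBookkeepingOfReach`** (crux
stmt-CriticalPhenomena-14004, line `pick-half-plane`, serving `stub_halfPlaneInputs`, wave 4):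
the per-domain boundary bookkeeping [A] in the lead's `∃ K`-form, for every non-interior lattice
site `s` that is REACHABLE from the normaliser's site `sb` in the boundary-site graph of `Λ`
WITHOUT THE ROOT (sites joined across the `𝕋`-edges dual to boundary darts `(v ∈ Λ, t ∉ Λ)` other
than the root).  Proof: a shortest such chain is duplicate-free (`SimpleGraph.Walk.bypass`); it
carries a trail of pairwise distinct boundary darts (`exists_trail`, `sites_eq_of_dart`); on a
flat floor WITHOUT PINCH the floor minus the root consists of two dead-end corridors of the
boundary-site graph entered only at their far ends (`floorSite_nbr`), so a duplicate-free chain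
from `sb` (off the corridors, as `b` is off the floor) crosses floor darts only TOWARDS the root
(`no_step_to_door`); conclude by `stub_halfPlaneInputs_boundaryBookkeepingPath` with
`K = ‖((2ζ − 1)/3)/2‖ = 1/(2√3)`.  What remains for [A]: reachability of every boundary site (the
boundary of a simply connected, connected hex domain is ONE circuit). [folklore] -/
theorem stub_halfPlaneInputs_boundaryBookkeepingOfReach :
    ∃ K : ℝ, ∀ (Λ : Finset HexVertex), hexDomainSimplyConnected Λ →
      (hexGraph.induce ((Λ : Finset HexVertex) : Set HexVertex)).Preconnected →
    ∀ (m k₁ k₂ ka : ℤ), (∀ k : ℤ, k₁ ≤ k → k ≤ k₂ → ((![k, m], 0) : HexVertex) ∈ Λ ∧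
        ((![k, m - 1], 1) : HexVertex) ∉ Λ ∧ (k < k₂ → ((![k, m], 1) : HexVertex) ∈ Λ) ∧
        ((![k, m - 1], 0) : HexVertex) ∉ Λ) → k₁ ≤ ka → ka ≤ k₂ →
    ∀ (ub wb : HexVertex), hexGraph.Adj ub wb → ub ∉ Λ → wb ∈ Λ →
      (∀ k : ℤ, k₁ ≤ k → k ≤ k₂ →
        s(ub, wb) ≠ s((((![k, m - 1] : Site 2)), (1 : Fin 2)), ((![k, m] : Site 2), (0 : Fin 2)))) →
    ∀ (H : Site 2 → ℂ),
      IsPotential Λ s((((![ka, m - 1] : Site 2)), (1 : Fin 2)), ((![ka, m] : Site 2), (0 : Fin 2))) H →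
    ∀ (sb : Site 2), sb ∈ hexFaceVertices ub → sb ∈ hexFaceVertices wb →
    ∀ (s : Site 2), IsLatticeSite Λ s → ¬ IsInteriorSite Λ s →
      Relation.ReflTransGen (fun p q : Site 2 => p ≠ q ∧ ∃ v ∈ Λ, ∃ t : HexVertex, t ∉ Λ ∧
        hexGraph.Adj v t ∧
        s(t, v) ≠ s((((![ka, m - 1] : Site 2)), (1 : Fin 2)), ((![ka, m] : Site 2), (0 : Fin 2))) ∧
        p ∈ hexFaceVertices v ∧ p ∈ hexFaceVertices t ∧
        q ∈ hexFaceVertices v ∧ q ∈ hexFaceVertices t) sb s →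
      (H s).re - (H sb).re ≤ K * ∑ v ∈ Λ, ∑ t ∈ (nbrs v).filter (· ∉ Λ),
        if (∀ k : ℤ, k₁ ≤ k → k ≤ k₂ →
            s(t, v) ≠ s((((![k, m - 1] : Site 2)), (1 : Fin 2)), ((![k, m] : Site 2), (0 : Fin 2))))
        then ‖hexParafermionicObservable Λ
          s((((![ka, m - 1] : Site 2)), (1 : Fin 2)), ((![ka, m] : Site 2), (0 : Fin 2)))
            hexCriticalFugacity 0 s(t, v)‖ else 0 :=
  ⟨_, fun _ hΛ _ _ _ _ _ hF4 hka₁ hka₂ _ _ hbadj hub hwb hboff _ hH _ hsbu hsbw _ _ _ hreach =>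
    reach_re_le hΛ hF4 hka₁ hka₂ hH (normaliserSite_ne_floorSite hF4 hbadj hub hwb hboff hsbu hsbw)
      hreach⟩

/-- **Registered sub-goal `stub_halfPlaneInputs_segmentEndTwoSidedOfReach`** (crux
stmt-CriticalPhenomena-14004, line `pick-half-plane`, serving `stub_halfPlaneInputs`): the
TWO-SIDED bound at the two END sites `(k₁, m)`, `(k₂ + 1, m)` of the root's floor — a
duplicate-free chain from the normaliser's site to an end site crosses no floor dart at all (it
would have to enter a dead-end corridor and come back), so the bookkeeping holds in both
directions: `|Re H(s_end) − Re H(sb)| ≤ K · Σ_{darts off the floor} Z`, for each end site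
reachable from `sb` in the boundary-site graph without the root (same `K = 1/(2√3)`). [folklore] -/
theorem stub_halfPlaneInputs_segmentEndTwoSidedOfReach :
    ∃ K : ℝ, ∀ (Λ : Finset HexVertex), hexDomainSimplyConnected Λ →
      (hexGraph.induce ((Λ : Finset HexVertex) : Set HexVertex)).Preconnected →
    ∀ (m k₁ k₂ ka : ℤ), (∀ k : ℤ, k₁ ≤ k → k ≤ k₂ → ((![k, m], 0) : HexVertex) ∈ Λ ∧
        ((![k, m - 1], 1) : HexVertex) ∉ Λ ∧ (k < k₂ → ((![k, m], 1) : HexVertex) ∈ Λ) ∧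
        ((![k, m - 1], 0) : HexVertex) ∉ Λ) → k₁ ≤ ka → ka ≤ k₂ →
    ∀ (ub wb : HexVertex), hexGraph.Adj ub wb → ub ∉ Λ → wb ∈ Λ →
      (∀ k : ℤ, k₁ ≤ k → k ≤ k₂ →
        s(ub, wb) ≠ s((((![k, m - 1] : Site 2)), (1 : Fin 2)), ((![k, m] : Site 2), (0 : Fin 2)))) →
    ∀ (H : Site 2 → ℂ),
      IsPotential Λ s((((![ka, m - 1] : Site 2)), (1 : Fin 2)), ((![ka, m] : Site 2), (0 : Fin 2))) H →
    ∀ (sb : Site 2), sb ∈ hexFaceVertices ub → sb ∈ hexFaceVertices wb →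
    ∀ (s : Site 2), (s = ![k₁, m] ∨ s = ![k₂ + 1, m]) →
      Relation.ReflTransGen (fun p q : Site 2 => p ≠ q ∧ ∃ v ∈ Λ, ∃ t : HexVertex, t ∉ Λ ∧
        hexGraph.Adj v t ∧
        s(t, v) ≠ s((((![ka, m - 1] : Site 2)), (1 : Fin 2)), ((![ka, m] : Site 2), (0 : Fin 2))) ∧
        p ∈ hexFaceVertices v ∧ p ∈ hexFaceVertices t ∧
        q ∈ hexFaceVertices v ∧ q ∈ hexFaceVertices t) sb s →
      |(H s).re - (H sb).re| ≤ K * ∑ v ∈ Λ, ∑ t ∈ (nbrs v).filter (· ∉ Λ),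
        if (∀ k : ℤ, k₁ ≤ k → k ≤ k₂ →
            s(t, v) ≠ s((((![k, m - 1] : Site 2)), (1 : Fin 2)), ((![k, m] : Site 2), (0 : Fin 2))))
        then ‖hexParafermionicObservable Λ
          s((((![ka, m - 1] : Site 2)), (1 : Fin 2)), ((![ka, m] : Site 2), (0 : Fin 2)))
            hexCriticalFugacity 0 s(t, v)‖ else 0 := by
  refine ⟨‖((2 * triZeta - 1) / 3 : ℂ) / 2‖, fun Λ hΛ _ m k₁ k₂ ka hF4 hka₁ hka₂ ub wb hbadj hub hwb
    hboff H hH sb hsbu hsbw s hs hreach => abs_sub_le_iff.2 ⟨?_, ?_⟩⟩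
  · exact reach_re_le hΛ hF4 hka₁ hka₂ hH
      (normaliserSite_ne_floorSite hF4 hbadj hub hwb hboff hsbu hsbw) hreach
  · refine reach_re_le hΛ hF4 hka₁ hka₂ hH (fun j hj₁ hj₂ h => ?_) ?_
    · rcases hs with rfl | rfl
      · have := congrFun h 0; simp at this; omega
      · have := congrFun h 0; simp at this; omega
    · -- the relation is symmetric, so reachability is
      clear hs
      induction hreach with
      | refl => exact Relation.ReflTransGen.refl
      | tail _ hbc ih =>
        obtain ⟨hne, v, hv, t, ht, hvt, hr, hbv, hbt, hcv, hct⟩ := hbc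
        exact Relation.ReflTransGen.head ⟨hne.symm, v, hv, t, ht, hvt, hr, hcv, hct, hbv, hbt⟩ ih


end Summit.CriticalPhenomena.SAWScalingLimit.Theorems.PickHalfPlane.BoundaryExactness
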